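import Summits.PneNP.PneNP.Theorems.ChebyshevTracialDesignJuntaMatchingLaw
import HarnessLib

/-!
# Cell pnp-psdrank, route `ChebyshevTracialDesign`: the VIRTUAL VALUE OF A MATCHING MONOMIAL around a cut — the matching-side
# pattern polynomial with its value at the virtual level in CLOSED FORM (Grigoriev ⊗ Grigoriev pseudo-matching moments)
# (crux `TracialDecayExp20`, stmt-PneNP-19878; eng g13, MEMO-13 §4 — infrastructure for matching-side low-degree pricing)

Part E₂ of the junta series (`…JuntaMatchingLaw.pattern_poly_exists_pm`, `junta_sum_law_pm`) gives, for a cut `U` (`|U| = t`,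
`|S ∖ U| = s`) and a window edge set `E` (`y` crossing edges, `z` edges inside `U`, `e` inside the complement), a real polynomial `P_E` of
degree `≤ |E|` with `#{M ⊇ E : #cr(U,M) = a} = #{M : #cr(U,M) = a}·P_E(a)` along `a + 2i = t`, `a + 2i' = s`, and `P_E(0) ≥ 0`. For pricing
DENSE low-degree matching-side factors (entries in the span of the monomials `1[F ⊆ M]`, `|F| ≤ k'`, as in
`Literature.Combinatorics.Optimization.IsLowDegreeM`) the SIGN of `P_E(0)` is not enough — one needs the quadratic form
`Σ_{F,F'} c_F c_{F'} P_{F ∪ F'}(0)` — so this file exports the VALUE: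

* §1 `cast_descFactorial_two_mul` — `[t]_{2z} = ∏_{j<z}(t − 2j) · ∏_{j<z}(t − 1 − 2j)` in `ℝ`.
* §2 **`pattern_poly_pm_explicit`** — the pattern polynomial of part E₂ with the extra conjunct
  `P(0) = [y = 0] · ∏_{j<z}(t − 1 − 2j)⁻¹ · ∏_{j<e}(s − 1 − 2j)⁻¹`:
  the virtual level sees NO crossing edge, and an internal edge pattern is weighted by the product of the PSEUDO-MATCHING MOMENTS
  `m_t(z) = ∏_{j<z}(t − 1 − 2j)⁻¹` of `K_t` and `m_s(e)` of `K_s` — Grigoriev's symmetric pseudo-expectation for "`K_t` has a perfect matching"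
  (`t` odd) [cite: Grigoriev2001TCS, Cor. 2 (p. 622)], in the closed form of Potechin's story pseudo-expectation `Ẽ[x_{ij}] = 1/(t−1)`,
  `Ẽ[∏_{e∈G} x_e] = ∏_{j<|G|}(t−1−2j)⁻¹` [cite: Potechin2019, Example 3.4 and Cor. 3.10 (LIPIcs 124, 61:7–61:9)].
* §3 **`card_superset_level_eq_poly`** — the single-monomial level law with this explicit virtual value: for a partial matching `F` of a
  vertex set `W ⊆ S`, `#{M ∈ PM(S) : F ⊆ M, #cr(U,M) = a} = #{M : #cr(U,M) = a} · P_F(a)` with `deg P_F ≤ |F|` and `P_F(0)` as in §2;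
  `card_superset_level_eq_zero` — an edge set contained in no perfect matching has all level counts `0`.
Consequence (MEMO-13 §4, next file): the design value of `X ⊗ B Bᵀ` with `B` of matching-degree `≤ k'`, `2k' ≤ D`, `X` ARBITRARY psd, is
`−(#t-cuts)⁻¹ Σ_U (Ẽ_{U} ⊗ Ẽ_{Ū})[‖X_U^{1/2} B‖²_F] ≤ 0` as soon as the two pseudo-matching functionals are positive semidefinite to degree `k'`
(Potechin's Thm 1.2: up to index degree `(t−1)/2`), the matching-side twin of `…JuntaLowDegree.sum_levelWeight_trace_nonpos_of_lowDegree`.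
Stature: support/instrument (finite combinatorics; no defs, axioms standard). WHAT THIS IS NOT: no positivity statement, nothing on the dense
cell, nothing on psd rank, no P-vs-NP content. Supports stmt-PneNP-19878.
-/

set_option linter.dupNamespace false -- `Summit.PneNP.PneNP.…`: summit = sub-problem (D-0017)

noncomputable section

namespace Summit.PneNP.PneNP.Theorems.ChebyshevTracialDesignMonomialVirtualValue

open Finset Polynomial Literature.Barriers.PneNP Literature.Combinatorics.SimpleGraph.CycleSpace
open Summit.PneNP.PneNP.Theorems.ChebyshevTracialDesignJunta

variable {V : Type*} [DecidableEq V]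

/-! ### §1 Splitting a descending factorial into even and odd steps -/

/-- `[t]_{2z} = ∏_{j<z}(t − 2j) · ∏_{j<z}(t − 1 − 2j)` (real form, `2z ≤ t`). [folklore] -/
theorem cast_descFactorial_two_mul (t z : ℕ) (h : 2 * z ≤ t) :
    ((t.descFactorial (2 * z) : ℕ) : ℝ) =
      (∏ j ∈ range z, ((t : ℝ) - 2 * j)) * ∏ j ∈ range z, ((t : ℝ) - 1 - 2 * j) := by
  induction z with
  | zero => simp
  | succ z ih =>
    have h' : 2 * z ≤ t := by omega
    rw [show 2 * (z + 1) = 2 * z + 1 + 1 from by ring, Nat.descFactorial_succ, Nat.descFactorial_succ, Nat.cast_mul,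
      Nat.cast_mul, ih h', prod_range_succ, prod_range_succ, Nat.cast_sub (by omega), Nat.cast_sub h']
    push_cast
    ring

/-- The even-step product is positive: `∏_{j<z}(t − 2j) > 0` for `2z ≤ t`. [folklore] -/
theorem prod_sub_two_mul_pos (t z : ℕ) (h : 2 * z ≤ t) : 0 < ∏ j ∈ range z, ((t : ℝ) - 2 * j) := by
  refine prod_pos fun j hj => ?_
  have := mem_range.1 hj
  have : (2 : ℝ) * j + 2 ≤ t := by exact_mod_cast (by omega : 2 * j + 2 ≤ t)
  linarith

/-- The odd-step product is positive: `∏_{j<z}(t − 1 − 2j) > 0` for `2z ≤ t`. [folklore] -/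
theorem prod_sub_one_sub_two_mul_pos (t z : ℕ) (h : 2 * z ≤ t) : 0 < ∏ j ∈ range z, ((t : ℝ) - 1 - 2 * j) := by
  refine prod_pos fun j hj => ?_
  have := mem_range.1 hj
  have : (2 : ℝ) * j + 2 ≤ t := by exact_mod_cast (by omega : 2 * j + 2 ≤ t)
  linarith

/-! ### §2 The matching-side pattern polynomial with its virtual value in closed form -/

/-- **Matching-side pattern polynomial, explicit virtual value.** For `x = y + z + e` window edges (`y` crossing, `z` inside the cut of
size `t`, `e` inside the complement of size `s`; `y + 2z ≤ t`, `y + 2e ≤ s`) there is a real polynomial `P` of degree `≤ x` with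
`P(a)·[t]_{y+2z}·[s]_{y+2e} = [a]_y · 2^z[i]_z · 2^e[i']_e` whenever `a + 2i = t`, `a + 2i' = s` (as in part E₂), AND
`P(0) = [y = 0] · (∏_{j<z}(t − 1 − 2j))⁻¹ · (∏_{j<e}(s − 1 − 2j))⁻¹` — the product of the pseudo-matching moments of `K_t` and `K_s`.
[cite: Potechin2019, Example 3.4 and Cor. 3.10 (LIPIcs 124, 61:7–61:9)] [cite: Grigoriev2001TCS, Cor. 2 (p. 622)] -/
theorem pattern_poly_pm_explicit (t s : ℕ) {x y z ee : ℕ} (hx : y + z + ee = x) (h1 : y + 2 * z ≤ t)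
    (h2 : y + 2 * ee ≤ s) :
    ∃ P : Polynomial ℝ, P.natDegree ≤ x ∧
      P.eval 0 = (if y = 0 then (∏ j ∈ range z, ((t : ℝ) - 1 - 2 * j))⁻¹ * (∏ j ∈ range ee, ((s : ℝ) - 1 - 2 * j))⁻¹
        else 0) ∧
      ∀ a i i' : ℕ, a + 2 * i = t → a + 2 * i' = s →
        P.eval (a : ℝ) * (((t.descFactorial (y + 2 * z) : ℕ) : ℝ) * ((s.descFactorial (y + 2 * ee) : ℕ) : ℝ)) =
          ((a.descFactorial y * (2 ^ z * i.descFactorial z) * (2 ^ ee * i'.descFactorial ee) : ℕ) : ℝ) := by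
  have hD1 : 0 < (t.descFactorial (y + 2 * z) : ℝ) := by
    have : t.descFactorial (y + 2 * z) ≠ 0 := fun h0 => by
      rw [Nat.descFactorial_eq_zero_iff_lt] at h0; omega
    positivity
  have hD2 : 0 < (s.descFactorial (y + 2 * ee) : ℝ) := by
    have : s.descFactorial (y + 2 * ee) ≠ 0 := fun h0 => by
      rw [Nat.descFactorial_eq_zero_iff_lt] at h0; omega
    positivity
  set κ : ℝ := ((t.descFactorial (y + 2 * z) : ℝ) * (s.descFactorial (y + 2 * ee) : ℝ))⁻¹ with hκ
  have hlin : ∀ c : ℝ, (C c - X : Polynomial ℝ).natDegree ≤ 1 := fun c =>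
    (natDegree_sub_le _ _).trans (max_le (by simp) natDegree_X_le)
  refine ⟨C κ * (∏ j ∈ range y, (X - C (j : ℝ))) * (∏ j ∈ range z, (C ((t : ℝ) - 2 * j) - X)) *
      ∏ j ∈ range ee, (C ((s : ℝ) - 2 * j) - X), ?_, ?_, ?_⟩
  · have hy : (∏ j ∈ range y, (X - C (j : ℝ))).natDegree ≤ y := by
      refine (natDegree_prod_le _ _).trans ?_
      refine (sum_le_sum fun (j : ℕ) _ => (natDegree_X_sub_C ((j : ℕ) : ℝ)).le).trans ?_
      simp
    have hz : (∏ j ∈ range z, (C ((t : ℝ) - 2 * j) - X)).natDegree ≤ z := by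
      refine (natDegree_prod_le _ _).trans ((sum_le_sum fun j _ => hlin _).trans ?_); simp
    have he : (∏ j ∈ range ee, (C ((s : ℝ) - 2 * j) - X)).natDegree ≤ ee := by
      refine (natDegree_prod_le _ _).trans ((sum_le_sum fun j _ => hlin _).trans ?_); simp
    refine (natDegree_mul_le.trans (add_le_add (natDegree_mul_le.trans (add_le_add
      ((natDegree_C_mul_le _ _).trans hy) hz)) he)).trans ?_
    omega
  · -- the value at the virtual level `X = 0`
    simp only [eval_mul, eval_C, eval_prod, eval_sub, eval_X, sub_zero]
    rcases Nat.eq_zero_or_pos y with hy0 | hy0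
    · subst hy0
      simp only [range_zero, prod_empty, mul_one, if_true, zero_add] at hκ ⊢
      have hz2 : 2 * z ≤ t := by omega
      have he2 : 2 * ee ≤ s := by omega
      rw [hκ, cast_descFactorial_two_mul t z hz2, cast_descFactorial_two_mul s ee he2]
      have p1 := prod_sub_two_mul_pos t z hz2
      have p2 := prod_sub_one_sub_two_mul_pos t z hz2
      have p3 := prod_sub_two_mul_pos s ee he2
      have p4 := prod_sub_one_sub_two_mul_pos s ee he2
      field_simp
    · have : ∏ j ∈ range y, ((0 : ℝ) - (j : ℝ)) = 0 := prod_eq_zero (mem_range.2 hy0) (by simp)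
      rw [this, if_neg hy0.ne']; simp
  · intro a i i' hai hai'
    have evY : ((∏ j ∈ range y, (X - C (j : ℝ))).eval (a : ℝ)) = ∏ j ∈ range y, ((a : ℝ) - j) := by
      rw [eval_prod]; exact prod_congr rfl fun j _ => by simp
    have evZ : ((∏ j ∈ range z, (C ((t : ℝ) - 2 * j) - X)).eval (a : ℝ)) = 2 ^ z * ∏ j ∈ range z, ((i : ℝ) - j) := by
      rw [eval_prod]
      have ht' : (t : ℝ) = a + 2 * i := by exact_mod_cast hai.symm
      rw [show (2 : ℝ) ^ z = ∏ _j ∈ range z, (2 : ℝ) by simp, ← prod_mul_distrib]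
      exact prod_congr rfl fun j _ => by simp [ht']; ring
    have evE : ((∏ j ∈ range ee, (C ((s : ℝ) - 2 * j) - X)).eval (a : ℝ)) =
        2 ^ ee * ∏ j ∈ range ee, ((i' : ℝ) - j) := by
      rw [eval_prod]
      have hs' : (s : ℝ) = a + 2 * i' := by exact_mod_cast hai'.symm
      rw [show (2 : ℝ) ^ ee = ∏ _j ∈ range ee, (2 : ℝ) by simp, ← prod_mul_distrib]
      exact prod_congr rfl fun j _ => by simp [hs']; ring
    rw [eval_mul, eval_mul, eval_mul, eval_C, evY, evZ, evE, hκ]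
    have hA : ((a.descFactorial y : ℕ) : ℝ) = ∏ j ∈ range y, ((a : ℝ) - j) := by
      by_cases hya : y ≤ a
      · exact cast_descFactorial_eq_prod hya
      · rw [Nat.descFactorial_eq_zero_iff_lt.2 (not_le.1 hya), Nat.cast_zero]
        exact (prod_eq_zero (mem_range.2 (not_le.1 hya)) (by simp)).symm
    have hB : ((i.descFactorial z : ℕ) : ℝ) = ∏ j ∈ range z, ((i : ℝ) - j) := by
      by_cases hzi : z ≤ i
      · exact cast_descFactorial_eq_prod hzi
      · rw [Nat.descFactorial_eq_zero_iff_lt.2 (not_le.1 hzi), Nat.cast_zero]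
        exact (prod_eq_zero (mem_range.2 (not_le.1 hzi)) (by simp)).symm
    have hC : ((i'.descFactorial ee : ℕ) : ℝ) = ∏ j ∈ range ee, ((i' : ℝ) - j) := by
      by_cases hei : ee ≤ i'
      · exact cast_descFactorial_eq_prod hei
      · rw [Nat.descFactorial_eq_zero_iff_lt.2 (not_le.1 hei), Nat.cast_zero]
        exact (prod_eq_zero (mem_range.2 (not_le.1 hei)) (by simp)).symm
    push_cast
    rw [hA, hB, hC]
    field_simp

/-! ### §3 The single-monomial level law with explicit virtual value -/

/-- **Level law of one matching monomial, with its virtual value.** Let `U ⊆ S` (`|U| = t`, `|S ∖ U| = s`) and let `F` be a perfect matching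
of a vertex set `W ⊆ S` (a partial matching of `S`), with `y` edges crossing `U`, `z` inside `U` and `|F| − y − z` inside `S ∖ U`. Then there is
a real polynomial `P_F` of degree `≤ |F|` such that `#{M ∈ PM(S) : F ⊆ M, #cr(U,M) = a} = #{M ∈ PM(S) : #cr(U,M) = a} · P_F(a)` along
`a + 2i = t`, `a + 2i' = s`, and `P_F(0) = [y = 0]·∏_{j<z}(t−1−2j)⁻¹·∏_{j<|F|−z}(s−1−2j)⁻¹` — the monomial `x_F = 1[F ⊆ M]` is priced at the
virtual level by the Grigoriev ⊗ Grigoriev pseudo-matching moment of `(F ∩ E(U), F ∩ E(S ∖ U))`, and by `0` if `F` crosses `U`.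
[cite: Potechin2019, Example 3.4 and Cor. 3.10 (LIPIcs 124, 61:7–61:9)] [cite: Rothvoss2017, §2 (PDF p. 6)] -/
theorem card_superset_level_eq_poly {S U W : Finset V} (hU : U ⊆ S) (hW : W ⊆ S) {F : Finset (Sym2 V)} (hF : IsPMOn W F)
    {t s : ℕ} (hUc : U.card = t) (hSc : (S \ U).card = s) :
    ∃ P : Polynomial ℝ, P.natDegree ≤ F.card ∧
      P.eval 0 = (if (F.filter fun e => cutCount U e = 1).card = 0 then
        (∏ j ∈ range (F.filter fun e => cutCount U e = 2).card, ((t : ℝ) - 1 - 2 * j))⁻¹ *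
        (∏ j ∈ range (F.card - (F.filter fun e => cutCount U e = 1).card - (F.filter fun e => cutCount U e = 2).card),
          ((s : ℝ) - 1 - 2 * j))⁻¹ else 0) ∧
      ∀ a i i' : ℕ, a + 2 * i = t → a + 2 * i' = s →
        ((((perfectMatchings S).filter fun M => F ⊆ M ∧ (M.filter fun e => cutCount U e = 1).card = a).card : ℕ) : ℝ) =
          ((((perfectMatchings S).filter fun M => (M.filter fun e => cutCount U e = 1).card = a).card : ℕ) : ℝ) *
            P.eval (a : ℝ) := by
  classical
  set y := (F.filter fun e => cutCount U e = 1).card with hy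
  set z := (F.filter fun e => cutCount U e = 2).card with hz
  have hyz : y + z ≤ F.card := by
    rw [hy, hz, ← card_union_of_disjoint (disjoint_filter.2 fun e _ h1 h2 => by omega)]
    exact card_le_card (union_subset (filter_subset _ _) (filter_subset _ _))
  have hUW : (U ∩ W).card = y + 2 * z := card_inter_verts_eq hF
  have hWU := card_verts_sdiff_eq (U := U) hF
  have hle1 : y + 2 * z ≤ t := by rw [← hUW, ← hUc]; exact card_le_card inter_subset_left
  have hle2 : y + 2 * (F.card - y - z) ≤ s := by
    have : (W \ U).card ≤ (S \ U).card := card_le_card (sdiff_subset_sdiff hW Subset.rfl)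
    rw [hSc] at this; omega
  obtain ⟨P, hPdeg, hP0, hPval⟩ := pattern_poly_pm_explicit t s (x := F.card) (y := y) (z := z)
    (ee := F.card - y - z) (by omega) hle1 hle2
  refine ⟨P, hPdeg, hP0, fun a i i' hai hai' => ?_⟩
  have hUc' : U.card = a + 2 * i := by rw [hUc, hai]
  have hSc' : (S \ U).card = a + 2 * i' := by rw [hSc, hai']
  have hnat := card_pm_fiber_ratio_nat hU hW hF hUc' hSc'
  have hreal := hPval a i i' hai hai'
  have hD : (0 : ℝ) < ((t.descFactorial (y + 2 * z) : ℕ) : ℝ) * ((s.descFactorial (y + 2 * (F.card - y - z)) : ℕ) : ℝ) := by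
    have h1' : t.descFactorial (y + 2 * z) ≠ 0 := fun h0 => by
      rw [Nat.descFactorial_eq_zero_iff_lt] at h0; omega
    have h2' : s.descFactorial (y + 2 * (F.card - y - z)) ≠ 0 := fun h0 => by
      rw [Nat.descFactorial_eq_zero_iff_lt] at h0; omega
    positivity
  have hnatR := congrArg (fun m : ℕ => (m : ℝ)) hnat
  simp only [Nat.cast_mul] at hnatR
  rw [hai, hai'] at hnatR
  rw [hy, hz] at hreal hD
  refine mul_right_cancel₀ hD.ne' ?_
  rw [hnatR]
  push_cast at hreal ⊢
  rw [← hreal]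
  ring

/-- An edge set contained in NO perfect matching of `S` (e.g. not a partial matching) has all level counts `0`. [folklore] -/
theorem card_superset_level_eq_zero {S U : Finset V} {F : Finset (Sym2 V)} (hF : ∀ M ∈ perfectMatchings S, ¬ F ⊆ M) (a : ℕ) :
    ((perfectMatchings S).filter fun M => F ⊆ M ∧ (M.filter fun e => cutCount U e = 1).card = a).card = 0 := by
  rw [card_eq_zero, filter_eq_empty_iff]
  exact fun M hM h => hF M hM h.1

/-- **Dichotomy for an arbitrary edge set.** Either some perfect matching of `S` contains `F` — and then `F` is a perfect matching of the
vertices it covers, so `card_superset_level_eq_poly` applies with `W = {v ∈ S : v ∈ some edge of F}` — or all its level counts vanish.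
[folklore] -/
theorem isPMOn_verts_of_subset {S : Finset V} {F M : Finset (Sym2 V)} (hM : M ∈ perfectMatchings S) (hFM : F ⊆ M) :
    IsPMOn (S.filter fun v => ∃ e ∈ F, v ∈ e) F :=
  isPMOn_verts (mem_perfectMatchings.1 hM) hFM

end Summit.PneNP.PneNP.Theorems.ChebyshevTracialDesignMonomialVirtualValue
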